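import Mathlib
import Literature.Analysis.FluidPDE.TypeIAncientMild
import Literature.Analysis.FluidPDE.AxisymmetricEuler
import Summits.NavierStokesRegularity.NavierStokesRegularity.Theses.SymmetryModuliCount

/-!
# Crux AxisymEndLiouville (stmt-NavierStokesRegularity-14061) — ideator 2 sketch (round 1)

First lemmas of two levers, stated over existing declarations (no proofs; elaboration only).

* Lever B `swirl-paraboloid-maximum-principle`: `SwirlBarrierFromPast` → `SwirlParaboloidMaxPrinciple`
  → `SwirlBound` → `SwirlVanishes` → `SwirlFreeLiouville` → (with `AxisNormalisation`) the crux.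
* Lever A `duhamel-exterior-decay-bootstrap`: `PlanarSmallness` → `DecayBootstrapStep` → `DecayTransfer`
  → KNSS Thm 5.3 (`knss_bound_C_over_r_holds`) → the crux.
-/

open Literature.Analysis.FluidPDE

namespace Summit.NavierStokesRegularity.NavierStokesRegularity.Cruxes.AxisymEndLiouville.Ideator2

local notation "ℝ³" => EuclideanSpace ℝ (Fin 3)

/-! ### Common normal form: z-axis, whole past -/

/-- The crux in normal form (axis = the `x 2`-axis through `0`, symmetry on all of `t < 0`). -/
def AxisymTypeIAncientLiouville : Prop :=
  ∀ (C : ℝ) (u : ℝ → ℝ³ → ℝ³), IsTypeIAncientMild C u → (∀ t < 0, IsAxisymmetric (u t)) →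
    ∀ t < 0, ∀ x, u t x = 0

/-- VERBATIM copy of the crux signature `SymmetryModuliCount.AxisymEndLiouville` (stmt-14061; the
farm build of the route module predates rev 5, so the decl is not yet importable by name — refuter
note g48; replace by the route decl once the farm rebuilds). -/
def AxisymEndLiouvilleSig : Prop :=
  ∀ (C : ℝ) (u : ℝ → EuclideanSpace ℝ (Fin 3) → EuclideanSpace ℝ (Fin 3)), Literature.Analysis.FluidPDE.IsTypeIAncientMild C u → ∀ (c : EuclideanSpace ℝ (Fin 3)) (A : EuclideanSpace ℝ (Fin 3) →L[ℝ] EuclideanSpace ℝ (Fin 3)) (θ : ℝ), (∀ x, inner ℝ (A x) x = 0) → A ≠ 0 → θ ≤ 0 → (∀ t < θ, ∀ x, fderiv ℝ (u t) x (A (x - c)) - A (u t x) = 0) → ∀ t < θ, ∀ x, u t x = 0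

/-- Normalisation glue (S): infinitesimal rotational symmetry `∇u·A(x−c) − Au = 0` on an end
`t < θ` integrates to axisymmetry about the line `c + ker A`; conjugating by a rigid motion and
shifting time by `−θ ≥ 0` (`IsTypeIAncientMild.comp_sub_right`) lands in the normal form. -/
def AxisNormalisation : Prop :=
  AxisymTypeIAncientLiouville → AxisymEndLiouvilleSig

/-! ### Lever B: the paraboloid maximum principle for the swirl `Γ = swirl (u t) = r u_θ` -/

/-- **First lemma of Lever B (the comparison from a finite past time).** For `R ≥ 4C` the function
`ψ = M + C·r·((−t)(−t₀))^{−1/4}` is a supersolution of the swirl equation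
`Γ_t + (b + 2e_r/r)·∇Γ = ΔΓ` (`swirl_transport_holds`) on `{r > R√(−t)}` because
`(∂_t + (b_r + 2/r)∂_r − Δ)(r(−t)^{−1/4}) = (−t)^{−1/4}[r/(4(−t)) + b_r + 1/r] ≥ 0` iff
`ρ/4 + 1/ρ ≥ C ⇐ ρ := r/√(−t) ≥ 4C` (using `|b_r| ≤ |u| ≤ C/√(−t)`); it dominates `|Γ| ≤ r|u| ≤ Cr/√(−t₀)`
at `t = t₀` and `M` on the lateral surface; weak maximum principle (`weak_max_principle`, any drift)
with the quadratic escape barrier `ε e^{μ(t−t₀)}(1+|x|²)`. -/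
def SwirlBarrierFromPast : Prop :=
  ∀ (C : ℝ) (u : ℝ → ℝ³ → ℝ³), IsTypeIAncientMild C u → (∀ t < 0, IsAxisymmetric (u t)) →
    ∀ (R M t₀ : ℝ), 4 * C ≤ R → 0 < R → t₀ < 0 →
      (∀ t < 0, ∀ x, cylRadius x = R * Real.sqrt (-t) → |swirl (u t) x| ≤ M) →
      ∀ t ∈ Set.Ioo t₀ 0, ∀ x, R * Real.sqrt (-t) ≤ cylRadius x →
        |swirl (u t) x| ≤ M + C * cylRadius x * ((-t) * (-t₀)) ^ (-(1 / 4 : ℝ))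

/-- **Lever B, Step 1 (paraboloid maximum principle; `t₀ → −∞` in `SwirlBarrierFromPast`, which is
where ancientness is spent):** outside the paraboloid `r = R√(−t)`, `R ≥ 4C`, the swirl is bounded by
its supremum ON the paraboloid. -/
def SwirlParaboloidMaxPrinciple : Prop :=
  ∀ (C : ℝ) (u : ℝ → ℝ³ → ℝ³), IsTypeIAncientMild C u → (∀ t < 0, IsAxisymmetric (u t)) →
    ∀ (R M : ℝ), 4 * C ≤ R → 0 < R →
      (∀ t < 0, ∀ x, cylRadius x = R * Real.sqrt (-t) → |swirl (u t) x| ≤ M) →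
      ∀ t < 0, ∀ x, R * Real.sqrt (-t) ≤ cylRadius x → |swirl (u t) x| ≤ M

/-- Corollary of Step 1 with `R = 4C` and `|Γ| ≤ r‖u‖ ≤ 4C²` on and inside the paraboloid
(`abs_swirl_le_cylRadius_mul_norm`): the swirl of every axisymmetric member of `A_C` is bounded. -/
def SwirlBound : Prop :=
  ∀ (C : ℝ) (u : ℝ → ℝ³ → ℝ³), IsTypeIAncientMild C u → (∀ t < 0, IsAxisymmetric (u t)) →
    ∀ t < 0, ∀ x, |swirl (u t) x| ≤ 4 * C ^ 2

/-- **Lever B, Step 2 (no interior plateau = Lei–Ren–Zhang 2019 §4 run with scalings instead of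
time shifts):** `sup |Γ|` is approached inside the solid paraboloid `{M/(2C) ≤ r/√(−t) ≤ 4C}`;
renormalise near-maximisers to `t = −1` by the symmetries of `A_C^{axi}` (scaling, axial shift,
rotation), extract a limit in `A_C` (KNSS Lemma 6.1 for the class), and the strong maximum
principle / KNSS Lemma 2.1 (`KNSS2009_lemma21_holds`) for the swirl equation off the axis (drift
bounded by `C` on `t ≤ −1`) forces `Γ ≡ sup` off the axis at `t = −1`, contradicting `Γ = O(r)`. -/
def SwirlVanishes : Prop :=
  ∀ (C : ℝ) (u : ℝ → ℝ³ → ℝ³), IsTypeIAncientMild C u → (∀ t < 0, IsAxisymmetric (u t)) →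
    ∀ t < 0, HasNoSwirl (u t)

/-- **Lever B, Step 3 (glue, S):** swirl-free members of `A_C` vanish — KNSS Thm 5.2 in duality form
(`knss2009_axisymmetric_no_swirl_holds`) on the bounded shifts `u(·−δ)`
(`IsTypeIAncientMild.isBoundedAncientMildSolution_sub`) makes every slice `β(t) e_z`, and
`IsTypeIAncientMild.eq_zero_of_slice_const` kills it. -/
def SwirlFreeLiouville : Prop :=
  ∀ (C : ℝ) (u : ℝ → ℝ³ → ℝ³), IsTypeIAncientMild C u → (∀ t < 0, IsAxisymmetric (u t)) →
    (∀ t < 0, HasNoSwirl (u t)) → ∀ t < 0, ∀ x, u t x = 0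

/-- Composition of Lever B (pure logic). -/
theorem axisymTypeIAncientLiouville_of_leverB (h2 : SwirlVanishes) (h3 : SwirlFreeLiouville) :
    AxisymTypeIAncientLiouville :=
  fun C u hu hax => h3 C u hu hax (h2 C u hu hax)

/-- Lever B reaches the crux by name, given the normalisation glue. -/
theorem axisymEndLiouville_of_leverB (hN : AxisNormalisation) (h2 : SwirlVanishes)
    (h3 : SwirlFreeLiouville) : AxisymEndLiouvilleSig :=
  hN (axisymTypeIAncientLiouville_of_leverB h2 h3)

/-! ### Lever A: time-decay ⇒ space-decay by the absolutely convergent ancient Oseen integral -/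

/-- **First lemma of Lever A (uniform planar smallness at horizontal–parabolic infinity):** by
compactness of `A_C` about receding axes (`exists_holder_quarter_of_oseenMild`,
`tendsto_oseenDuhamel_of_tendsto_of_bound`, `eq_of_tendstoLocallyUniformly_of_rot_about`) and the
PROVED planar Type-I Liouville theorem `KNSS2009_typeI_rate_liouville_holds`. -/
def PlanarSmallness : Prop :=
  ∀ C : ℝ, ∀ ε > 0, ∃ ρ₀ : ℝ, 0 < ρ₀ ∧ ∀ (u : ℝ → ℝ³ → ℝ³), IsTypeIAncientMild C u →
    (∀ t < 0, IsAxisymmetric (u t)) →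
    ∀ t < 0, ∀ x, ρ₀ * Real.sqrt (-t) ≤ cylRadius x → Real.sqrt (-t) * ‖u t x‖ ≤ ε

/-- **Lever A, the decisive bootstrap step:** a parabolic decay exponent `γ > 1/2` upgrades to the
`1/r` law in ONE application of the fully ancient Oseen formula
`u(t) = −∫_{−∞}^t e^{(t−τ)Δ}P∇·(u⊗u)dτ` (Koch–Tataru bound `norm_oseenKernel_le_oseenMajorant`):
deep past `≤ 2cC²/√S`, interior paraboloid (a line dipole) `≤ 2πcC²/r`, exterior near/far parts
`O_{A,γ}(1)/r`; no smallness and no a-priori finiteness of `sup r‖u‖` are used. -/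
def DecayBootstrapStep : Prop :=
  ∀ (C A γ ρ₀ : ℝ), 1 / 2 < γ → γ < 1 → 0 < ρ₀ → ∃ K ρ₁ : ℝ, 0 < ρ₁ ∧
    ∀ (u : ℝ → ℝ³ → ℝ³), IsTypeIAncientMild C u → (∀ t < 0, IsAxisymmetric (u t)) →
      (∀ t < 0, ∀ x, ρ₀ * Real.sqrt (-t) ≤ cylRadius x →
        Real.sqrt (-t) * ‖u t x‖ ≤ A * (cylRadius x / Real.sqrt (-t)) ^ (-γ)) →
      ∀ t < 0, ∀ x, ρ₁ * Real.sqrt (-t) ≤ cylRadius x → cylRadius x * ‖u t x‖ ≤ K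

/-- **Output of Lever A:** the KNSS Thm 5.3 hypothesis `r‖u‖ ≤ K` for every axisymmetric member of
`A_C` (inside the paraboloid `r ≤ ρ₁√(−t)` trivially `r‖u‖ ≤ Cρ₁`). Then `knss_bound_C_over_r_holds`
on the shifts `u(·−δ)` gives `AxisymTypeIAncientLiouville`. -/
def DecayTransfer : Prop :=
  ∀ C : ℝ, ∃ K : ℝ, ∀ (u : ℝ → ℝ³ → ℝ³), IsTypeIAncientMild C u → (∀ t < 0, IsAxisymmetric (u t)) →
    ∀ t < 0, ∀ x, cylRadius x * ‖u t x‖ ≤ K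

end Summit.NavierStokesRegularity.NavierStokesRegularity.Cruxes.AxisymEndLiouville.Ideator2
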